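import Mathlib.Analysis.InnerProductSpace.Laplacian
import Mathlib.Analysis.InnerProductSpace.Adjoint
import Mathlib.Analysis.InnerProductSpace.Trace
import Mathlib.Analysis.Calculus.Gradient.Basic
import Mathlib.Analysis.Calculus.ContDiff.Basic
import Mathlib.Analysis.Calculus.FDeriv.Symmetric
import Mathlib.Analysis.Calculus.LineDeriv.IntegrationByParts
import Mathlib.LinearAlgebra.CrossProduct
import Mathlib.LinearAlgebra.Trace
import Mathlib.Geometry.Euclidean.Angle.Unoriented.CrossProduct
import Mathlib.MeasureTheory.Integral.Bochner.Basic
import Mathlib.MeasureTheory.Measure.Haar.OfBasis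
import Literature.Analysis.FunctionSpaces.SobolevDomain
import HarnessLib

-- provenance: harness21/H21/H21/Prelude/FluidKinetic/VectorCalculus.lean @ 3d603bd (interim HEAD d8f2665); M5 mechanical rewrite
/-!
# Vector calculus for fluid mechanics: divergence, curl, convection, energy functionals

Trunk: FluidKinetic (outline `H21/Outlines/FluidKinetic.md`, item F1 `VectorCalculus`; notions
`vector_calculus_div_curl`, `energy_dissipation_functionals`).

Let `E` be a finite-dimensional real inner product space (physical space, typically
`ℝ³ = EuclideanSpace ℝ (Fin 3)`) and `F'` a finite-dimensional real inner product space (the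
target of vector fields). This file provides the pointwise differential operators and the global
energy functionals used throughout the incompressible-fluid families (`ns`, `turb`, `hilbert6`):

* `Literature.Fluid.divergence v x = tr (Dv(x))`, `Literature.Fluid.IsDivFree v` — **verbatim** the accepted
  `Literature.Analysis.FluidPDE.NSWave0.divergence` / `Literature.Analysis.FluidPDE.NSWave0.IsDivFree` of `Statements/NS/Wave0` (not imported here to keep the
  prelude independent of statement files; the definitions agree by `rfl`).
* `Literature.Fluid.convect u v x = Dv(x)[u(x)] = ((u·∇)v)(x)`, `Literature.Fluid.partialDeriv e v x = Dv(x) e`.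
* `Literature.Fluid.frobeniusNormSq L = ∑ᵢ ‖L eᵢ‖²` (Hilbert–Schmidt / Frobenius norm squared of a linear
  map, basis-independent: `frobeniusNormSq_eq_sum`, `frobeniusNormSq_eq_trace`),
  `Literature.Fluid.gradNormSq v = ∫ |∇v|²`, `Literature.Fluid.kineticEnergy v = ½ ∫ |v|²`,
  `Literature.Fluid.eEnergy v = ∫⁻ ‖v‖ₑ²` (the integrand of `Literature.Analysis.FluidPDE.HasBoundedEnergy`).
* on `ℝ³`: `Literature.Analysis.FluidPDE.cross` (the cross product transported to `EuclideanSpace ℝ (Fin 3)` along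
  `WithLp.toLp/ofLp`, Mathlib idiom of `InnerProductGeometry.norm_ofLp_crossProduct`),
  `Literature.Analysis.FluidPDE.curl`; on general `E`: `Literature.Fluid.spin v x = Dv − Dvᵀ` (twice the antisymmetric
  part of the velocity gradient).
* weak calculus on the whole space, **reusing** the accepted G03 file
  `Literature.Prelude.Sobolev.SobolevDomain`: test functions are `Literature.IsTestFunctionOn ⊤ φ`, weak
  gradients are `Literature.HasWeakFDerivOn ⊤ volume` (abbreviated `Literature.Analysis.FluidPDE.HasWeakGradient`);
  `Literature.Fluid.IsWeaklyDivFree u` (`∫ u·∇θ = 0` for all test `θ`) and the extended dissipation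
  functional `Literature.Fluid.eWeakGradL2Sq u = ∫⁻ |∇u|² ∈ [0, ∞]`.

## Mathlib search

Mathlib (this pin) has `fderiv`, `gradient`, `LinearMap.trace`, `LinearMap.trace_eq_sum_inner`,
`ContinuousLinearMap.adjoint`, `LinearMap.adjoint`, `crossProduct` (on `Fin 3 → R`, notation
`⨯₃`), `InnerProductSpace.laplacian`, `stdOrthonormalBasis`; it has a Frobenius norm only on
`Matrix` (`Matrix.frobeniusNormedAddCommGroup`, a non-instance def), and no divergence, curl or
Hilbert–Schmidt norm of a linear map between inner product spaces. Test functions and weak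
derivatives are the accepted H21 ones (not redefined).

## Design notes

* With `open scoped ContDiff ENNReal` the token `∞` is ambiguous; this file opens only the
  `ENNReal` scope (smoothness exponents appear as numerals `1`, `2` or via
  `IsTestFunctionOn`).
* `volume` on `E` is Mathlib's `measureSpaceOfInnerProductSpace` (Lebesgue measure normalised on
  an orthonormal cube), available under `[FiniteDimensional ℝ E] [MeasurableSpace E]
  [BorelSpace E]`, matching `Literature.Analysis.FluidPDE.HasBoundedEnergy`.
* `[CompleteSpace E]` (needed by `ContinuousLinearMap.adjoint`) is obtained from
  `FiniteDimensional.complete` via `haveI` inside `spin`.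
* `eWeakGradL2Sq u` is an infimum over weak gradients (a.e. unique by
  `Literature.Analysis.FunctionSpaces.HasWeakFDerivOn.unique`, so the infimum is attained when nonempty) and is `∞ = ⊤` when `u`
  has no weak gradient (documented junk value, the standard convention `‖∇u‖₂ = ∞` for
  `u ∉ Ḣ¹`).

## References

* C. L. Fefferman, *Existence and smoothness of the Navier–Stokes equation*, Clay Millennium
  problem description (2000/2006), eqs. (1), (2), (7).
* A. J. Majda, A. L. Bertozzi, *Vorticity and Incompressible Flow* (CUP 2002), Ch. 1
  (§1.1–1.2: vorticity, deformation matrix, energy).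
* L. C. Evans, *Partial Differential Equations*, 2nd ed. (2010), §5.2.1 (weak derivatives).
-/

noncomputable section

open MeasureTheory TopologicalSpace WithLp Matrix
open scoped InnerProductSpace RealInnerProductSpace ENNReal

namespace Literature.Analysis.FluidPDE

variable {E : Type*} [NormedAddCommGroup E] [InnerProductSpace ℝ E] [FiniteDimensional ℝ E]
variable {F' : Type*} [NormedAddCommGroup F'] [InnerProductSpace ℝ F']

/-! ### Pointwise differential operators -/

/-- The (pointwise, classical) divergence of a vector field `v : E → E`: the trace of its Fréchet
derivative, `div v (x) = ∑ᵢ ∂ᵢ vᵢ (x)` (Fefferman, Clay problem description, eq. (2);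
Majda–Bertozzi, §1.1). **Verbatim** the accepted `Literature.Analysis.FluidPDE.NSWave0.divergence` (Statements/NS/Wave0),
restated here so that the prelude does not import statement files. Junk value `0` where `v` is
not differentiable (inherited from `fderiv`). [folklore] -/
def VectorCalculus.divergence (v : E → E) (x : E) : ℝ :=
  LinearMap.trace ℝ E (fderiv ℝ v x : E →ₗ[ℝ] E)

/-- A vector field is divergence free if its divergence vanishes everywhere (Fefferman, eq. (2):
`div u = 0`). **Verbatim** the accepted `Literature.Analysis.FluidPDE.NSWave0.IsDivFree`. [folklore] -/
def VectorCalculus.IsDivFree (v : E → E) : Prop :=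
  ∀ x, VectorCalculus.divergence v x = 0

/-- The convective derivative `((u·∇)v)(x) = Dv(x)[u(x)]` of a field `v : E → F'` along a vector
field `u : E → E` (Fefferman, eq. (1): `∑ⱼ uⱼ ∂ⱼ vᵢ`; Majda–Bertozzi, eq. (1.4)). [folklore] -/
def convect (u : E → E) (v : E → F') (x : E) : F' :=
  fderiv ℝ v x (u x)

/-- The directional (partial) derivative `∂ₑ v (x) = Dv(x) e` of `v : E → F'` along a fixed vector
`e : E` (Majda–Bertozzi, §1.1, `∂v/∂xⱼ` for `e = eⱼ`). Junk value `0` where `v` is not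
differentiable. [folklore] -/
def partialDeriv (e : E) (v : E → F') (x : E) : F' :=
  fderiv ℝ v x e

omit [FiniteDimensional ℝ E] in
/-- Unfolding the convective derivative (Fefferman, eq. (1)). [folklore] -/
@[simp]
theorem convect_apply (u : E → E) (v : E → F') (x : E) :
    convect u v x = fderiv ℝ v x (u x) := rfl

omit [FiniteDimensional ℝ E] in
/-- Unfolding the partial derivative (Majda–Bertozzi, §1.1). [folklore] -/
@[simp]
theorem partialDeriv_apply (e : E) (v : E → F') (x : E) :
    partialDeriv e v x = fderiv ℝ v x e := rfl

omit [FiniteDimensional ℝ E] in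
/-- The divergence is the sum `∑ᵢ ⟪bᵢ, Dv(x) bᵢ⟫` over any orthonormal basis, i.e.
`div v = ∑ᵢ ∂ᵢ vᵢ` in orthonormal coordinates (Majda–Bertozzi, §1.1; via Mathlib's
`LinearMap.trace_eq_sum_inner`). [folklore] -/
theorem divergence_eq_sum_inner_fderiv {ι : Type*} [Fintype ι] (b : OrthonormalBasis ι ℝ E)
    (v : E → E) (x : E) :
    VectorCalculus.divergence v x = ∑ i, ⟪b i, fderiv ℝ v x (b i)⟫ := by
  rw [VectorCalculus.divergence, LinearMap.trace_eq_sum_inner _ b]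
  rfl

/-! ### The Frobenius (Hilbert–Schmidt) norm of the velocity gradient -/

section Frobenius

variable [FiniteDimensional ℝ F']

/-- The squared Frobenius (Hilbert–Schmidt) norm `|L|² = ∑ᵢ ‖L eᵢ‖²` of a linear map
`L : E →L[ℝ] F'`, summed over the standard orthonormal basis `stdOrthonormalBasis ℝ E`; for
`L = Dv(x)` this is `|∇v(x)|² = ∑ᵢⱼ (∂ᵢ vⱼ)²`, the pointwise dissipation density
(Majda–Bertozzi, §1.2, eq. (1.29) `∫ |∇v|²`). Independent of the basis
(`frobeniusNormSq_eq_sum`) and equal to `tr (Lᵀ L)` (`frobeniusNormSq_eq_trace`). [folklore] -/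
def frobeniusNormSq (L : E →L[ℝ] F') : ℝ :=
  ∑ i, ‖L (stdOrthonormalBasis ℝ E i)‖ ^ 2

/-- For any orthonormal basis `b`, `∑ᵢ ‖L bᵢ‖² = tr (Lᵀ L)` (Majda–Bertozzi, §1.2; proof:
`‖L bᵢ‖² = ⟪bᵢ, Lᵀ L bᵢ⟫` and Mathlib's `LinearMap.trace_eq_sum_inner`). [folklore] -/
theorem sum_norm_sq_apply_eq_trace {ι : Type*} [Fintype ι] (b : OrthonormalBasis ι ℝ E)
    (L : E →L[ℝ] F') :
    ∑ i, ‖L (b i)‖ ^ 2 =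
      LinearMap.trace ℝ E (LinearMap.adjoint (L : E →ₗ[ℝ] F') ∘ₗ (L : E →ₗ[ℝ] F')) := by
  rw [LinearMap.trace_eq_sum_inner _ b]
  refine Finset.sum_congr rfl fun i _ => ?_
  rw [LinearMap.comp_apply, LinearMap.adjoint_inner_right, ContinuousLinearMap.coe_coe,
    real_inner_self_eq_norm_sq]

/-- The Frobenius norm is the trace of `Lᵀ L`: `|L|² = tr (L† ∘ L)` (Majda–Bertozzi, §1.2). [folklore] -/
theorem frobeniusNormSq_eq_trace (L : E →L[ℝ] F') :
    frobeniusNormSq L =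
      LinearMap.trace ℝ E (LinearMap.adjoint (L : E →ₗ[ℝ] F') ∘ₗ (L : E →ₗ[ℝ] F')) :=
  sum_norm_sq_apply_eq_trace _ L

/-- Basis independence of the Frobenius norm: `|L|² = ∑ᵢ ‖L bᵢ‖²` for every orthonormal basis
`b` of `E` (Majda–Bertozzi, §1.2). [folklore] -/
theorem frobeniusNormSq_eq_sum {ι : Type*} [Fintype ι] (b : OrthonormalBasis ι ℝ E)
    (L : E →L[ℝ] F') : frobeniusNormSq L = ∑ i, ‖L (b i)‖ ^ 2 := by
  rw [frobeniusNormSq_eq_trace, sum_norm_sq_apply_eq_trace b]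

omit [FiniteDimensional ℝ F'] in
/-- The Frobenius norm squared is nonnegative (Majda–Bertozzi, §1.2). [folklore] -/
theorem frobeniusNormSq_nonneg (L : E →L[ℝ] F') : 0 ≤ frobeniusNormSq L :=
  Finset.sum_nonneg fun _ _ => sq_nonneg _

omit [FiniteDimensional ℝ F'] in
/-- The Frobenius norm of the zero map vanishes (Majda–Bertozzi, §1.2). [folklore] -/
@[simp]
theorem frobeniusNormSq_zero : frobeniusNormSq (0 : E →L[ℝ] F') = 0 := by
  simp [frobeniusNormSq]

end Frobenius

/-! ### Energy and dissipation functionals -/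

section Energy

variable [MeasurableSpace E] [BorelSpace E]

/-- The (total) squared gradient norm `‖∇v‖₂² = ∫ |∇v(x)|² dx` of a field `v : E → F'`, with
the Frobenius norm of `Dv(x)` as density (Majda–Bertozzi, §1.2, eq. (1.29): the dissipation
`ν ∫ |∇v|²`). Bochner integral: junk value `0` if `x ↦ |Dv(x)|²` is not integrable; see
`eWeakGradL2Sq` for the `[0, ∞]`-valued weak version. [folklore] -/
def VectorCalculus.gradNormSq (v : E → F') : ℝ :=
  ∫ x, frobeniusNormSq (fderiv ℝ v x)

/-- The kinetic energy `E(v) = ½ ∫ ‖v(x)‖² dx` of a field `v : E → F'` (Majda–Bertozzi, §1.2,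
eq. (1.28); Fefferman, eq. (7) without the factor `½`). Bochner integral: junk value `0` if
`‖v‖²` is not integrable; see `eEnergy` for the `[0, ∞]`-valued version. [folklore] -/
def VectorCalculus.kineticEnergy (v : E → F') : ℝ :=
  2⁻¹ * ∫ x, ‖v x‖ ^ 2

/-- The extended energy `∫⁻ ‖v(x)‖ₑ² dx ∈ [0, ∞]`, the integrand of the accepted
`Literature.Analysis.FluidPDE.HasBoundedEnergy` (Fefferman, eq. (7)). No junk value. [folklore] -/
def eEnergy (v : E → F') : ℝ≥0∞ :=
  ∫⁻ x, ‖v x‖ₑ ^ 2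

omit [InnerProductSpace ℝ F'] in
/-- The kinetic energy is nonnegative (Majda–Bertozzi, §1.2). [folklore] -/
theorem kineticEnergy_nonneg (v : E → F') : 0 ≤ VectorCalculus.kineticEnergy v :=
  mul_nonneg (inv_nonneg.2 zero_le_two) (integral_nonneg fun _ => sq_nonneg _)

omit [InnerProductSpace ℝ F'] in
/-- For an `L²` field the extended energy is finite and equals `2 · E(v)`:
`∫⁻ ‖v‖ₑ² = ofReal (2 * kineticEnergy v)` (Fefferman, eq. (7); Majda–Bertozzi, eq. (1.28)). [folklore] -/
theorem eEnergy_eq_ofReal (v : E → F') (hv : MemLp v 2 (volume : Measure E)) :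
    eEnergy v = ENNReal.ofReal (2 * VectorCalculus.kineticEnergy v) := by
  have hint : Integrable (fun x => ‖v x‖ ^ 2) (volume : Measure E) :=
    hv.integrable_norm_pow two_ne_zero
  rw [VectorCalculus.kineticEnergy, ← mul_assoc, mul_inv_cancel₀ two_ne_zero, one_mul,
    ofReal_integral_eq_lintegral_ofReal hint (Filter.Eventually.of_forall fun _ => sq_nonneg _),
    eEnergy]
  refine lintegral_congr fun x => ?_
  rw [← ofReal_norm, ENNReal.ofReal_pow (norm_nonneg _)]

end Energy

/-! ### Three dimensions: cross product and curl -/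

/-- The cross product on `ℝ³ = EuclideanSpace ℝ (Fin 3)`, transported from Mathlib's
`crossProduct` (`⨯₃`, on `Fin 3 → ℝ`) along `WithLp.toLp`/`WithLp.ofLp` — the Mathlib idiom of
`InnerProductGeometry.norm_ofLp_crossProduct` (Majda–Bertozzi, §1.1; e.g. `ω × v`, eq. (1.33)).
Lives in the `Literature.Fluid` namespace (not an extension of a Mathlib namespace). [folklore] -/
def cross (v w : EuclideanSpace ℝ (Fin 3)) : EuclideanSpace ℝ (Fin 3) :=
  toLp 2 (ofLp v ⨯₃ ofLp w)

/-- `‖v × w‖ = ‖v‖ ‖w‖ sin ∠(v, w)` (Mathlib's `InnerProductGeometry.norm_ofLp_crossProduct`). [folklore] -/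
theorem norm_cross (v w : EuclideanSpace ℝ (Fin 3)) :
    ‖cross v w‖ = ‖v‖ * ‖w‖ * Real.sin (InnerProductGeometry.angle v w) :=
  InnerProductGeometry.norm_ofLp_crossProduct v w

/-- The curl (vorticity) `ω = curl v` of a vector field `v : ℝ³ → ℝ³`, with components
`(∂₂v₃ − ∂₃v₂, ∂₃v₁ − ∂₁v₃, ∂₁v₂ − ∂₂v₁)` (Majda–Bertozzi, §1.1, eq. (1.11) and §1.2), where
`∂ⱼ vᵢ (x) = Dv(x) eⱼ · eᵢ` with `eⱼ = EuclideanSpace.single j 1` (indices `0, 1, 2` in Lean).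
Junk value `0` where `v` is not differentiable. [folklore] -/
def curl (v : EuclideanSpace ℝ (Fin 3) → EuclideanSpace ℝ (Fin 3)) (x : EuclideanSpace ℝ (Fin 3)) :
    EuclideanSpace ℝ (Fin 3) :=
  let D : Fin 3 → Fin 3 → ℝ := fun j i => fderiv ℝ v x (EuclideanSpace.single j 1) i
  toLp 2 ![D 1 2 - D 2 1, D 2 0 - D 0 2, D 0 1 - D 1 0]

/-- Twice the antisymmetric part of the velocity gradient, `spin v x = Dv(x) − Dv(x)ᵀ`
(the vorticity matrix `2Ω` with `Ω = ½(∇v − ∇vᵀ)`, Majda–Bertozzi, §1.2, eq. (1.20)–(1.22)), on a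
general finite-dimensional inner product space; in `ℝ³`, `spin v x h = ω × h` with `ω = curl v x`
(Majda–Bertozzi, eq. (1.24)) and `‖curl v x‖² = ½ |spin v x|²`
(`norm_curl_sq_eq_frobeniusNormSq_spin`). [folklore] -/
def spin (v : E → E) (x : E) : E →L[ℝ] E :=
  haveI : CompleteSpace E := FiniteDimensional.complete ℝ E
  fderiv ℝ v x - ContinuousLinearMap.adjoint (fderiv ℝ v x)

/-- `div (curl v) = 0` for a `C²` vector field on `ℝ³` (Majda–Bertozzi, §1.1; symmetry of second
derivatives). [cite: MajdaBertozziCUP2002, §1.1 (vector identities)] -/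
def divergence_curl_eq_zero : Prop :=
  ∀ (v : EuclideanSpace ℝ (Fin 3) → EuclideanSpace ℝ (Fin 3)) (hv : ContDiff ℝ 2 v) (x : EuclideanSpace ℝ (Fin 3)),
    VectorCalculus.divergence (curl v) x = 0

/-- `curl (∇θ) = 0` for a `C²` scalar function on `ℝ³` (Majda–Bertozzi, §1.1; symmetry of second
derivatives). [cite: MajdaBertozziCUP2002, §1.1 (vector identities)] -/
def curl_gradient_eq_zero : Prop :=
  ∀ (θ : EuclideanSpace ℝ (Fin 3) → ℝ) (hθ : ContDiff ℝ 2 θ) (x : EuclideanSpace ℝ (Fin 3)),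
    curl (gradient θ) x = 0

/-- Product rule `div (v × w) = w · curl v − v · curl w` for differentiable fields on `ℝ³`
(Majda–Bertozzi, §1.1, vector identities). [cite: MajdaBertozziCUP2002, §1.1 (vector identities)] -/
def divergence_cross : Prop :=
  ∀ (v w : EuclideanSpace ℝ (Fin 3) → EuclideanSpace ℝ (Fin 3)) (x : EuclideanSpace ℝ (Fin 3)) (hv : DifferentiableAt ℝ v x) (hw : DifferentiableAt ℝ w x),
    VectorCalculus.divergence (fun y => cross (v y) (w y)) x = ⟪w x, curl v x⟫ - ⟪v x, curl w x⟫

/-- In `ℝ³` the vorticity carries the same information as the spin matrix: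
`‖curl v (x)‖² = ½ |Dv(x) − Dv(x)ᵀ|²` (Frobenius norm), for `v` differentiable at `x`
(Majda–Bertozzi, §1.2, eqs. (1.22)–(1.24)). [cite: MajdaBertozziCUP2002, §1.2 eqs. (1.22)–(1.24)] -/
def norm_curl_sq_eq_frobeniusNormSq_spin : Prop :=
  ∀ (v : EuclideanSpace ℝ (Fin 3) → EuclideanSpace ℝ (Fin 3)) (x : EuclideanSpace ℝ (Fin 3)) (hv : DifferentiableAt ℝ v x),
    ‖curl v x‖ ^ 2 = 2⁻¹ * frobeniusNormSq (spin v x)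

/-! ### Weak calculus on the whole space (reusing `Literature.Prelude.Sobolev.SobolevDomain`) -/

section Weak

variable [MeasurableSpace E] [BorelSpace E]

/-- A locally integrable vector field `u : E → E` is *weakly divergence free* if
`∫ ⟪u, ∇θ⟫ = 0` for every real test function `θ ∈ C_c^∞(E)` (test functions in the sense of the
accepted `Literature.IsTestFunctionOn ⊤`), the distributional form of `div u = 0`
(Fefferman, eq. (2); Majda–Bertozzi, §1.2 and Ch. 3; Evans, *PDE*, §5.2.1). [folklore] -/
def IsWeaklyDivFree (u : E → E) : Prop :=
  ∀ θ : E → ℝ, FunctionSpaces.IsTestFunctionOn (⊤ : Opens E) θ → ∫ x, ⟪u x, gradient θ x⟫ = 0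

/-- `HasWeakGradient u G`: `G : E → E →L[ℝ] F'` is a weak gradient of `u : E → F'` on the whole
space w.r.t. Lebesgue measure — a thin abbreviation of the accepted G03 predicate
`Literature.HasWeakFDerivOn ⊤ volume u G` (Evans, *PDE*, §5.2.1); there `∫ x in ↑⊤, …` is `∫ x, …` by
`Measure.restrict_univ`. Uniqueness a.e. and the `C¹` case are `HasWeakFDerivOn.unique` and
`HasWeakFDerivOn.of_contDiff`. [folklore] -/
abbrev HasWeakGradient (u : E → F') (G : E → E →L[ℝ] F') : Prop :=
  FunctionSpaces.HasWeakFDerivOn (⊤ : Opens E) volume u G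

/-- The extended dissipation functional `‖∇u‖₂² = ∫⁻ |G(x)|² dx ∈ [0, ∞]` of a field with weak
gradient `G` (Frobenius norm density), as an infimum over all weak gradients of `u` — these are
a.e. unique (`HasWeakFDerivOn.unique`), so the infimum is attained when `u` has a weak gradient;
it is `⊤` when `u` has none (documented junk value = the convention `‖∇u‖₂ = ∞` for `u ∉ Ḣ¹`)
(Majda–Bertozzi, §1.2, eq. (1.29) and Ch. 3; Evans, *PDE*, §5.2.1). [folklore] -/
def eWeakGradL2Sq (u : E → F') : ℝ≥0∞ :=
  ⨅ (G : E → E →L[ℝ] F') (_ : HasWeakGradient u G), ∫⁻ x, ENNReal.ofReal (frobeniusNormSq (G x))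

/-- A `C¹`, divergence-free vector field is weakly divergence free: integrate
`div (θ u) = ∇θ · u + θ div u` over `E` (Evans, *PDE*, §5.2.1 and App. C.2, Gauss–Green;
Majda–Bertozzi, §1.2). Local integrability is automatic for continuous `u`. [cite: Evans2010, App. C.2 (Gauss–Green) with §5.2.1] -/
def VectorCalculus.IsDivFree.isWeaklyDivFree : Prop :=
  ∀ {u : E → E} (hu : VectorCalculus.IsDivFree u) (hu' : ContDiff ℝ 1 u),
    IsWeaklyDivFree u

/-- **Discharge** of `IsDivFree.isWeaklyDivFree`: a `C¹` vector field `u` with `div u = 0`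
satisfies `∫ ⟪u, ∇θ⟫ = 0` for every test function `θ`. Proof as printed (Evans, *PDE*, App. C.2,
Thm. 2 (integration by parts), boundary term absent since `θ ∈ C_c^∞(ℝⁿ)`; §5.2.1): in an
orthonormal frame `b`, `⟪u, ∇θ⟫ = ∑ᵢ uᵢ ∂ᵢθ`; integrate by parts coordinatewise (Mathlib's
`integral_bilinear_hasFDerivAt_right_eq_neg_left_of_integrable`) to get `-∫ θ ∑ᵢ ∂ᵢuᵢ = -∫ θ div u
= 0`. [cite: Evans2010, App. C.2 Thm. 2 with §5.2.1] -/
theorem VectorCalculus.IsDivFree.isWeaklyDivFree_holds : VectorCalculus.IsDivFree.isWeaklyDivFree (E := E) := by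
  intro u hu hu' θ hθ
  set b := stdOrthonormalBasis ℝ E
  have hθ1 : ContDiff ℝ 1 θ := hθ.contDiff.of_le (by exact_mod_cast le_top)
  have hθc : HasCompactSupport θ := hθ.hasCompactSupport
  have huc : Continuous u := hu'.continuous
  have hDu : Continuous (fderiv ℝ u) := hu'.continuous_fderiv one_ne_zero
  have hθcont : Continuous θ := hθ1.continuous
  have hDθ : Continuous (fderiv ℝ θ) := hθ1.continuous_fderiv one_ne_zero
  -- pointwise expansion in the orthonormal frame `b`
  have hexp : ∀ x, ⟪u x, gradient θ x⟫ = ∑ i, ⟪b i, u x⟫ * fderiv ℝ θ x (b i) := by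
    intro x
    rw [gradient, real_inner_comm, InnerProductSpace.toDual_symm_apply]
    conv_lhs => rw [← b.sum_repr' (u x)]
    simp [map_sum, map_smul, smul_eq_mul]
  -- integrability of the three products (continuous × compactly supported)
  have hI1 : ∀ i, Integrable (fun x => ⟪b i, fderiv ℝ u x (b i)⟫ * θ x) (volume : Measure E) :=
    fun i => ((continuous_const.inner (hDu.clm_apply continuous_const)).mul hθcont)
      |>.integrable_of_hasCompactSupport hθc.mul_left
  have hI2 : ∀ i, Integrable (fun x => ⟪b i, u x⟫ * fderiv ℝ θ x (b i)) (volume : Measure E) :=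
    fun i => ((continuous_const.inner huc).mul (hDθ.clm_apply continuous_const))
      |>.integrable_of_hasCompactSupport (hθc.fderiv_apply (𝕜 := ℝ) (b i)).mul_left
  have hI3 : ∀ i, Integrable (fun x => ⟪b i, u x⟫ * θ x) (volume : Measure E) :=
    fun i => ((continuous_const.inner huc).mul hθcont).integrable_of_hasCompactSupport hθc.mul_left
  -- integration by parts, one coordinate at a time
  have hibp : ∀ i, ∫ x, ⟪b i, u x⟫ * fderiv ℝ θ x (b i) =
      -∫ x, ⟪b i, fderiv ℝ u x (b i)⟫ * θ x := by
    intro i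
    have h := integral_bilinear_hasFDerivAt_right_eq_neg_left_of_integrable (μ := (volume : Measure E))
      (f := u) (f' := fderiv ℝ u) (g := θ) (g' := fderiv ℝ θ) (v := b i)
      (B := (ContinuousLinearMap.mul ℝ ℝ).comp (innerSL ℝ (b i)))
      (by simpa using hI1 i) (by simpa using hI2 i) (by simpa using hI3 i)
      (fun x _ => (hu'.differentiable one_ne_zero x).hasFDerivAt)
      (fun x _ => (hθ1.differentiable one_ne_zero x).hasFDerivAt)
    simpa using h
  calc ∫ x, ⟪u x, gradient θ x⟫
      = ∫ x, ∑ i, ⟪b i, u x⟫ * fderiv ℝ θ x (b i) := by simp_rw [hexp]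
    _ = ∑ i, ∫ x, ⟪b i, u x⟫ * fderiv ℝ θ x (b i) := integral_finsetSum _ fun i _ => hI2 i
    _ = -∫ x, ∑ i, ⟪b i, fderiv ℝ u x (b i)⟫ * θ x := by
      rw [integral_finsetSum _ fun i _ => hI1 i, ← Finset.sum_neg_distrib]
      exact Finset.sum_congr rfl fun i _ => hibp i
    _ = 0 := by
      have hdiv : ∀ x, ∑ i, ⟪b i, fderiv ℝ u x (b i)⟫ = 0 := fun x =>
        (divergence_eq_sum_inner_fderiv b u x).symm.trans (hu x)
      simp_rw [← Finset.sum_mul, hdiv, zero_mul, integral_zero, neg_zero]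

/-- The convective term is `L²`-skew on divergence-free fields:
`∫ ⟪(u·∇)u, u⟫ = 0` for a smooth, compactly supported, divergence-free `u : E → E`
(Majda–Bertozzi, §1.2, proof of Prop. 1.11 / eq. (1.30): `∫ (u·∇)u · u = ½ ∫ u · ∇|u|² = 0`). [cite: MajdaBertozziCUP2002, §1.2 (proof of Prop. 1.11, eq. (1.30))] -/
def integral_inner_convect_self_eq_zero : Prop :=
  ∀ {u : E → E} (hu : FunctionSpaces.IsTestFunctionOn (⊤ : Opens E) u) (hdiv : VectorCalculus.IsDivFree u),
    ∫ x, ⟪convect u u x, u x⟫ = 0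

/-- A `C¹` field with locally integrable derivative has its classical derivative as weak gradient
(specialisation of `HasWeakFDerivOn.of_contDiff` to the whole space; Evans, *PDE*, §5.2.1). [folklore] -/
def HasWeakGradient.of_contDiff : Prop :=
  ∀ {u : E → F'} (hu : ContDiff ℝ 1 u),
    HasWeakGradient u (fderiv ℝ u)

/- interim proof relied on results that are now named facts (D-0014); demoted to a fact by the M5 import, proof preserved:
:=
  HasWeakFDerivOn.of_contDiff (F := F') ⊤ volume hu
-/

end Weak

/-! ### Discharge: `curl ∇θ = 0` -/

/-- For a `C²` scalar function `θ` on `ℝ³`, the second partials read off the gradient field agree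
with the Hessian: `∂ⱼ (∇θ)ᵢ (x) = D(∇θ)(x) eⱼ · eᵢ = D²θ(x)(eⱼ)(eᵢ)` (`eₖ = EuclideanSpace.single k 1`).
Coordinates of `∇θ` are the directional derivatives `(∇θ)ᵢ = Dθ eᵢ` (Riesz, Mathlib's
`InnerProductSpace.toDual_symm_apply`); differentiate coordinatewise (`differentiableAt_euclidean`)
and compare derivatives by uniqueness. Auxiliary step of `curl_gradient_eq_zero_holds`
(Majda–Bertozzi, §1.2, eq. (1.20): the entries `∂vⁱ/∂xⱼ` of `∇v` for `v = ∇θ`). [folklore] -/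
theorem fderiv_gradient_single_apply (θ : EuclideanSpace ℝ (Fin 3) → ℝ) (hθ : ContDiff ℝ 2 θ)
    (x : EuclideanSpace ℝ (Fin 3)) (i j : Fin 3) :
    fderiv ℝ (gradient θ) x (EuclideanSpace.single j 1) i =
      fderiv ℝ (fderiv ℝ θ) x (EuclideanSpace.single j 1) (EuclideanSpace.single i 1) := by
  set e : Fin 3 → EuclideanSpace ℝ (Fin 3) := fun k => EuclideanSpace.single k 1 with he
  -- coordinates of the gradient are directional derivatives
  have hcoord : ∀ k, (fun y => gradient θ y k) = fun y => fderiv ℝ θ y (e k) := by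
    intro k
    funext y
    have h1 : ⟪gradient θ y, e k⟫ = gradient θ y k := by
      simp only [he, EuclideanSpace.inner_single_right, one_mul, RCLike.conj_to_real]
    rw [← h1, gradient, InnerProductSpace.toDual_symm_apply]
  -- the Hessian exists at `x`
  have hD : HasFDerivAt (fderiv ℝ θ) (fderiv ℝ (fderiv ℝ θ) x) x := by
    have h1 : ContDiff ℝ 1 (fderiv ℝ θ) := hθ.fderiv_right (m := 1) (by norm_num)
    exact (h1.differentiable one_ne_zero x).hasFDerivAt
  -- derivative of each coordinate of the gradient
  have hk : ∀ k, HasFDerivAt (fun y => gradient θ y k)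
      ((ContinuousLinearMap.apply ℝ ℝ (e k)).comp (fderiv ℝ (fderiv ℝ θ) x)) x := by
    intro k
    rw [hcoord k]
    exact (ContinuousLinearMap.apply ℝ ℝ (e k)).hasFDerivAt.comp x hD
  -- hence the gradient field is differentiable at `x`
  have hg : DifferentiableAt ℝ (gradient θ) x :=
    differentiableAt_euclidean.2 fun k => (hk k).differentiableAt
  -- compare the two derivatives of the `i`-th coordinate
  have hproj : HasFDerivAt (⇑(PiLp.proj 2 (fun _ : Fin 3 => ℝ) i) ∘ gradient θ)
      ((PiLp.proj 2 (fun _ : Fin 3 => ℝ) i).comp (fderiv ℝ (gradient θ) x)) x :=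
    (PiLp.proj 2 (fun _ : Fin 3 => ℝ) i).hasFDerivAt.comp x hg.hasFDerivAt
  have huniq := hproj.unique (hk i)
  have := congrArg (fun L : EuclideanSpace ℝ (Fin 3) →L[ℝ] ℝ => L (e j)) huniq
  simpa using this

/-- **Discharge** of `curl_gradient_eq_zero`: `curl (∇θ) = 0` on `ℝ³` for every `C²` scalar `θ`.
Source: Majda–Bertozzi define `curl v` componentwise in §1.2, eq. (1.20)
(`(∂₂v³ − ∂₃v², ∂₃v¹ − ∂₁v³, ∂₁v² − ∂₂v¹)`), and use `curl ∇p = 0` tacitly when "taking the curl of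
the Navier–Stokes equations" to obtain the vorticity equation (§2.1, eq. (2.5); cf. the companion
identities (2.96)–(2.97) in the proof of Prop. 2.16, §2.4.1); the book gives no separate proof — it is
the symmetry of second derivatives. Proof here: by `fderiv_gradient_single_apply` each component of
`curl (∇θ)(x)` is `D²θ(x)(eⱼ)(eᵢ) − D²θ(x)(eᵢ)(eⱼ)`, which vanishes by Schwarz's theorem for `C²`
maps (Mathlib's `ContDiffAt.isSymmSndFDerivAt`). [cite: MajdaBertozziCUP2002, §1.2 eq. (1.20) with §2.1 eq. (2.5)] -/
theorem curl_gradient_eq_zero_holds : curl_gradient_eq_zero := by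
  intro θ hθ x
  have hsymm : IsSymmSndFDerivAt ℝ θ x :=
    hθ.contDiffAt.isSymmSndFDerivAt (by simp)
  have hS : ∀ i j : Fin 3, fderiv ℝ (gradient θ) x (EuclideanSpace.single j 1) i =
      fderiv ℝ (gradient θ) x (EuclideanSpace.single i 1) j := by
    intro i j
    rw [fderiv_gradient_single_apply θ hθ x i j, fderiv_gradient_single_apply θ hθ x j i,
      hsymm.eq]
  simp only [curl]
  rw [hS 2 1, hS 0 2, hS 1 0, sub_self, sub_self, sub_self]
  ext k
  fin_cases k <;> simp

/-! ### Discharge of `divergence_cross` (product rule for `div (v × w)`) -/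

/-- The cross product on `ℝ³` bundled as a continuous bilinear map `crossCLM a b = cross a b`
(bilinearity of Mathlib's `crossProduct`; continuity is automatic in finite dimension via
`LinearMap.toContinuousLinearMap`). Used to differentiate `y ↦ v(y) × w(y)` by the product rule
`ContinuousLinearMap.hasFDerivAt_of_bilinear`. [folklore] -/
def crossCLM :
    EuclideanSpace ℝ (Fin 3) →L[ℝ] EuclideanSpace ℝ (Fin 3) →L[ℝ] EuclideanSpace ℝ (Fin 3) :=
  LinearMap.toContinuousLinearMap
    ((LinearMap.toContinuousLinearMap :
        (EuclideanSpace ℝ (Fin 3) →ₗ[ℝ] EuclideanSpace ℝ (Fin 3)) ≃ₗ[ℝ]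
          EuclideanSpace ℝ (Fin 3) →L[ℝ] EuclideanSpace ℝ (Fin 3)).toLinearMap ∘ₗ
      LinearMap.mk₂ ℝ cross
        (fun a b c => by simp [cross])
        (fun r a b => by simp [cross])
        (fun a b c => by simp [cross, map_add])
        (fun r a b => by simp [cross, map_smul]))

/-- Unfolding `crossCLM`. [folklore] -/
@[simp]
theorem crossCLM_apply (a b : EuclideanSpace ℝ (Fin 3)) : crossCLM a b = cross a b := rfl

/-- Product rule for the cross product of two vector fields on `ℝ³`:
`D(v × w)(x) h = v(x) × Dw(x) h + Dv(x) h × w(x)` (Mathlib's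
`ContinuousLinearMap.hasFDerivAt_of_bilinear` for the bilinear map `crossCLM`). [folklore] -/
theorem hasFDerivAt_cross {v w : EuclideanSpace ℝ (Fin 3) → EuclideanSpace ℝ (Fin 3)}
    {v' w' : EuclideanSpace ℝ (Fin 3) →L[ℝ] EuclideanSpace ℝ (Fin 3)} {x : EuclideanSpace ℝ (Fin 3)}
    (hv : HasFDerivAt v v' x) (hw : HasFDerivAt w w' x) :
    HasFDerivAt (fun y => cross (v y) (w y))
      (crossCLM.precompR (EuclideanSpace ℝ (Fin 3)) (v x) w' +
        crossCLM.precompL (EuclideanSpace ℝ (Fin 3)) v' (w x)) x :=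
  crossCLM.hasFDerivAt_of_bilinear hv hw

/-- **Discharge** of `divergence_cross`: `div (v × w) = w · curl v − v · curl w` at every point
where `v, w : ℝ³ → ℝ³` are differentiable. Majda–Bertozzi use this as one of the unnumbered "vector
identities" of Ch. 1–2 (§1.7, proof of Prop. 1.12, conservation of helicity and fluid impulse;
§2.4.1, proof of Prop. 2.16, next to (2.96) `div curl = 0`); it is folklore vector calculus.
Proof: by the product rule (`hasFDerivAt_cross`) `D(v × w)(x) h = v × Dw h + Dv h × w`; take the
trace in the standard orthonormal basis (`divergence_eq_sum_inner_fderiv`) and expand both sides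
in coordinates.
[cite: MajdaBertozziCUP2002, §1.7, proof of Prop. 1.12 (unnumbered vector identities); cf. §2.4.1 eqs. (2.96)–(2.97)] -/
theorem divergence_cross_holds : divergence_cross := by
  intro v w x hv hw
  rw [divergence_eq_sum_inner_fderiv (EuclideanSpace.basisFun (Fin 3) ℝ),
    (hasFDerivAt_cross hv.hasFDerivAt hw.hasFDerivAt).fderiv]
  simp only [EuclideanSpace.basisFun_inner, Fin.sum_univ_three]
  simp only [EuclideanSpace.basisFun_apply, _root_.add_apply, ContinuousLinearMap.precompR_apply,
    ContinuousLinearMap.compL_apply, ContinuousLinearMap.coe_comp, Function.comp_apply,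
    ContinuousLinearMap.precompL_apply, crossCLM_apply, cross, Fin.sum_univ_three,
    curl, cross_apply, PiLp.inner_apply, PiLp.add_apply,
    RCLike.inner_apply, conj_trivial, Matrix.cons_val_zero, Matrix.cons_val_one,
    Matrix.cons_val_two, Matrix.head_cons, Matrix.tail_cons]
  ring

end Literature.Analysis.FluidPDE
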